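import Summits.RiemannHypothesis.RiemannHypothesis.Theorems.TiltedLandingLaw421R3BotQ
import Summits.RiemannHypothesis.RiemannHypothesis.Theorems.TiltedLandingLaw421R3AddOn

/-! # TiltedLandingLaw421R3InitQ
SUPPORT module for crux `TiltedLandingLaw421` (stmt-RiemannHypothesis-24774), `--supports … --as helper` only: proves no stub, no crux; fully proved (no `sorry`).
W-08 ROUND-3b (director (CA336) KEY: part-1 tracked-class text = (iv) BAND, tenure row `g7/r3q/qd-band/`): INIT♯^Q — the Q-family's root inequality
`RhW08.SealSwapQ.RestInitBotQ` (module `…R3BotQ`, §Q.4) — is CLOSED IN THE TREE by composing the typing-robust bridge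
`RhW08.SealSwapQ.restInitBotQ_of_restInitBot : RhW08.SealSwap.RestInitBot → RestInitBotQ` (module `…R3BotQ`, §Q.5 rev d, C4 rh-idea-6 g26 RESULT-10)
with the LANDED round-3 discharge `RhW08.SealSwap.restInitBot : RhW08.SealSwap.RestInitBot` (`…R3AddOn`, p762578 / LAND #1016, C4 image B).
Hence the Q-thin `Cruxes/TiltedLandingLaw421/Lines/trkD_v3q.lean` carries NO INIT stub: its two stubs are `RhW08.SealSwapQ.RestSuccBotQ` / `RestRateBotQ` only.
Cut by tenure rh-tenure-earlyapp-1 g7 on the director's order ((CA336) PART 1 step (3)); proof term = the tenure pre-certificate's `InitBridge-4` probe `initSharpQ_closed_P4`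
(farm rc 0, axioms [propext, Classical.choice, Quot.sound] under all four candidate part-1 typings). Lands AFTER `…R3BotQ` (it imports it).
K = kernel-checked lemmas about MODEL sockets (combs / polynomials), not ζ/Ξ. Typed ≠ proved; RH is not proved; 24774 OPEN. -/

namespace RhW08.SealSwapQ

/-- ★ **INIT♯^Q closed**: the Q-family root inequality `RestInitBotQ` holds on every legal frame — round-3 `RhW08.SealSwap.restInitBot` (landed, `…R3AddOn`)
transported through `restInitBotQ_of_restInitBot` (the BAND class's level 0 contains the root-column states, `RhW08.QuadW.stTrkDQ_zero_of_stTrkD_zero`). -/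
theorem initSharpQ_closed : RestInitBotQ :=
  restInitBotQ_of_restInitBot RhW08.SealSwap.restInitBot

end RhW08.SealSwapQ
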